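import Literature.MathematicalPhysics.QuantumFieldTheory.Balaban1983to89.B14Radii
import Summits.QuantumFields.BalabanUV.T4Continuum.Support.TermwiseAnalyticMarginShrink

/-!
# NE7MarginDisplacementChain — row NE7, leaf T.2 (the ANALYTIC MARGIN, shared with road P4 and row NE9): node T's
# `LipBackground` PRODUCED from a chain of analyticity spaces through which the scale-`j` term is TRANSPORTED by the
# later steps' background maps, the ONE analytic input being a DISPLACEMENT bound on those maps (the complex `H_k`-shift,
# input (S1)) against the LAYERED LOSSES of [Balaban1988Convergent] (2.34)–(2.39) typed in tree `B14Radii`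

Cell `pub-balaban`, rung (B)+1 sub-cell t4, lineage `b2b-balaban-t4-ne7-p2` (CRUX PROVER NE7 #2 under the coordinator
ruling «YM redirect», 2026-08-21; generation 48), scratch `HOME/t4/b2b-balaban-t4-ne7-p2/g48/`.  HONEST FRAMING (page 1):
FIXED FINITE T⁴, rung (B)+1 = the `ε → 0` limit of unit-scale averaged expectations, CONDITIONAL on BetaPertH and the
nine spine estimates (0/9 proved); NOT infinite volume, NOT a mass gap, NOT the Clay problem.  NE7 is NOT PRINTED in
[Balaban1984PropagatorsI]–[Balaban1989LargeFieldII] and NOT proved here.  Every theorem below is [folklore] (set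
transport along a chain of maps, the triangle inequality, one call each of tree theorems BY NAME); nothing printed is
asserted; no definition; no `sorry`.

WHY.  Road P1's skeleton (`HOME/t4/skeletons/NE7-t4-ne7-p1.md` v1.7.1 §3) declares ONE own-open piece of NE7: leaf T.2,
typed in `Support/TermwiseAnalyticMarginShrink` as the hypothesis (SHRINK) of `lipBackground_of_shrinkingMargin` — «after
each further step the domain contains every point whose closed `d_k`-ball lay in the previous one, `Σ d_k ≤ ϱ₀∕2`» — with
the analyticity `hhol` and the bound `hbd` of the complexified term on the FINAL domain taken as further hypotheses.  The
printed mechanism behind p. 277's sentence («we have to use a part of the analyticity domains of terms in 𝐁_k for the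
function H_k … The analyticity domains become smaller after each step, but the difference is very small and exponentially
decreasing in the number of steps») is: the scale-`j` term, an analytic function `T₀` on its CREATION space `D 0`
((2.27)∕(2.28) p. 259), is re-expressed after each later step through the background map `Φ_k` (new complex background ↦
old one, (3.6) p. 266: `U_k = (exp iηH_k · U_{k+1})^{u⁻¹}`), `T_{k+1} = T_k ∘ Φ_k`, and stays analytic on the next printed
space `D (k+1)` (coefficients `shrink β (k+1−n)` instead of `shrink β (k−n)`, (2.34)–(2.39) p. 261) BECAUSE `Φ_k` maps
`D (k+1)` into `D k`: the shift `dist (Φ_k z) z` is at most the ROOM `(shrink β k − shrink β (k+1))·ϱ₀` (tree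
`B14Radii.absorb_step`; the shift's real small-field size is (3.7)–(3.8) p. 266, typed in `B14Sect3`; its COMPLEX sup bound
is the one input NOT printed as an inequality — (S1) of `HOME/t4/ideate/NE7-WALL.md` §3 item 5).  This file proves that
under exactly these data the hypotheses of `lipBackground_of_shrinkingMargin` ∕ `lipBackground_of_analyticMargin` on the
FINAL domain are INHERITED from the CREATION statements, so that T.2 reads: PRINTED-shape creation radii and bound
((2.27)∕(2.28), (2.42)) + DESIGN (the layered losses, kernel `B14Radii.sum_losses`) + (S1) (one-run displacement of the
complexified background maps, `≤` the room) + analyticity of those maps on the printed spaces (one-run, [I] §3 ∕ (3.6)) +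
this bookkeeping.  (SHRINK) itself is no longer an input: for the printed ball∕polydisc-shaped spaces it is design
(§2 `shrink_of_balls`), and for pulled-back spaces `D (k+1) = Φ_k⁻¹(D k)` it FOLLOWS from the displacement (§1
`shrink_of_preimage`).

WHAT IS PROVED ([folklore]).
§1 transport along a chain: `mapsTo_of_displacement` (a `d_k`-THIN next space + displacement `≤ d_k` ⟹ `Φ_k` maps
   `D (k+1)` into `D k`), `shrink_of_preimage` ((SHRINK) for pulled-back spaces from the displacement),
   `differentiableOn_transport`, `norm_transport_le` (analyticity and the creation bound are inherited by `T_{k+1} = T_k ∘ Φ_k`),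
   `transport_apply` (the transported value is the creation functional at the iterated pull-back).
§2 the layered design, by name from `B14Radii`: `sum_layeredLoss_le_half` (`Σ_{i<k}(shrink β i − shrink β (i+1))ϱ₀ ≤ ϱ₀∕2`
   for `0 ≤ β ≤ 1∕2`, printed `β = 1∕4`), `half_ball_subset_of_layered` (a space containing the ball of radius
   `shrink β k · ϱ₀` contains the `ϱ₀∕2`-ball), `thin_of_balls`, `shrink_of_balls` (for ball-shaped spaces of radii
   `shrink β k · ϱ₀` both the THIN clause and (SHRINK) hold with `d_k =` the loss — design, triangle inequality).
§3 ENDs: **`lipBackground_of_transportChain`** — node T's `LipBackground EA W κ (fun g j => 8·E₀∕ϱ₀ g j)` (the literal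
   constant of `lipBackground_of_shrinkingMargin`) from: creation margin `closedBall (ι U) (ϱ₀ g (scale X)) ⊆ Dch g X 0`,
   (SHRINK) + `hsum` (design), MAPS-INTO `MapsTo (Φ g X k) (Dch g X (k+1)) (Dch g X k)`, analyticity of the maps on
   `Dch g X (k+1)`, creation analyticity + creation bound of `T g X 0` on `Dch g X 0`, transport `T g X (k+1) = T g X k ∘ Φ g X k`,
   and the dictionary `T g X (N g X) (ι U) = EA g U X` — ONE CALL of `lipBackground_of_shrinkingMargin` with `hhol`∕`hbd`
   DISCHARGED by §1; **`lipBackground_of_displacementChain`** — the same with MAPS-INTO replaced by its (S1) producer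
   (THIN + displacement); **`lipBackground_of_layeredBalls`** — the same for ball-shaped spaces of radii `shrink β k · ϱ₀`
   about the embedded background (`0 ≤ β ≤ 1∕2`): the ONLY hypotheses left are creation analyticity∕bound, the maps'
   analyticity, the displacement `≤ (shrink β k − shrink β (k+1))·ϱ₀`, transport and the dictionary.
§4 `toy_transportChain` — non-vacuity with a genuinely moving chain (translations of `ℂ` by the losses).

NOT DELIVERED: (S1) for Bałaban's `H_k` on the complex spaces (one-run; real instance (3.7)–(3.8) printed, complex
extension p. 276 «[as in (I.3.13)]» prose; GAPS G-B14s-06); the creation statements for Bałaban's objects (NODE O).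
NOT NE7 (spine 0/9 unchanged), NOT summit progress.  HONEST DEPENDENCY: continuum YM on T⁴ ⇐ BetaPertH ∧ nine spine
estimates (0/9 proved); BetaPertH ⇐ (D1) ∧ (D4) ∧ CAP+tail; G-an2-4 gates asym, D1 and NE2/3/4.
-/

noncomputable section

open Finset Metric Set
open scoped BigOperators

namespace Summit.QuantumFields.BalabanUV.T4Continuum.NE7MarginDisplacementChain

open Literature.MathematicalPhysics.QuantumFieldTheory.Balaban1983to89
open Literature.MathematicalPhysics.QuantumFieldTheory.Balaban1983to89.B14Radii (shrink sum_losses one_sub_shrink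
  one_sub_le_shrink shrink_sub_succ)
open T4OutputRate (Carriers Functional LipBackground)
open TermwiseAnalyticMarginShrink (half_radius_survives lipBackground_of_shrinkingMargin)

/-! ## §1 Transport of a functional along a chain of background maps -/

section Transport

variable {E : Type*}

/-- **MAPS-INTO FROM A DISPLACEMENT BOUND.**  If the next space is `d k`-THIN inside the previous one (every point of
`D (k+1)` has its closed `d k`-ball in `D k`) and the step map moves points of `D (k+1)` by at most `d k`, then the step
map sends `D (k+1)` into `D k` — the shape of `B14Radii.absorb_step` («a shift of the argument by at most the one-step
room keeps it inside the larger space»). [folklore] -/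
theorem mapsTo_of_displacement [PseudoMetricSpace E] (D : ℕ → Set E) (Φ : ℕ → E → E) (d : ℕ → ℝ)
    (hthin : ∀ k, ∀ z ∈ D (k + 1), closedBall z (d k) ⊆ D k)
    (hdisp : ∀ k, ∀ z ∈ D (k + 1), dist (Φ k z) z ≤ d k) :
    ∀ k, MapsTo (Φ k) (D (k + 1)) (D k) :=
  fun k z hz => hthin k z hz (mem_closedBall.2 (hdisp k z hz))

/-- **(SHRINK) FOR PULLED-BACK SPACES.**  If `D (k+1)` contains the pull-back `Φ k ⁻¹' D k` and the step map moves every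
point whose closed `d k`-ball lies in `D k` by at most `d k`, then (SHRINK) holds: such a point lies in `D (k+1)`.
[folklore] -/
theorem shrink_of_preimage [PseudoMetricSpace E] (D : ℕ → Set E) (Φ : ℕ → E → E) (d : ℕ → ℝ)
    (hpre : ∀ k, Φ k ⁻¹' D k ⊆ D (k + 1))
    (hdisp : ∀ k z, closedBall z (d k) ⊆ D k → dist (Φ k z) z ≤ d k) :
    ∀ k z, closedBall z (d k) ⊆ D k → z ∈ D (k + 1) :=
  fun k z hz => hpre k (hz (mem_closedBall.2 (hdisp k z hz)))

/-- **ANALYTICITY IS INHERITED ALONG THE CHAIN.**  With `T (k+1) = T k ∘ Φ k`, the maps analytic on `D (k+1)` and sending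
it into `D k`, and `T 0` analytic on `D 0`, every `T k` is analytic on `D k`. [folklore] -/
theorem differentiableOn_transport [NormedAddCommGroup E] [NormedSpace ℂ E] (D : ℕ → Set E) (Φ : ℕ → E → E)
    (T : ℕ → E → ℂ) (hT : ∀ k, T (k + 1) = T k ∘ Φ k) (hinto : ∀ k, MapsTo (Φ k) (D (k + 1)) (D k))
    (hΦ : ∀ k, DifferentiableOn ℂ (Φ k) (D (k + 1))) (h0 : DifferentiableOn ℂ (T 0) (D 0)) :
    ∀ k, DifferentiableOn ℂ (T k) (D k) := by
  intro k
  induction k with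
  | zero => exact h0
  | succ k ih =>
      rw [hT k]
      exact ih.comp (hΦ k) (hinto k)

/-- **THE CREATION BOUND IS INHERITED ALONG THE CHAIN.** [folklore] -/
theorem norm_transport_le (D : ℕ → Set E) (Φ : ℕ → E → E) (T : ℕ → E → ℂ) {B : ℝ}
    (hT : ∀ k, T (k + 1) = T k ∘ Φ k) (hinto : ∀ k, MapsTo (Φ k) (D (k + 1)) (D k))
    (h0 : ∀ z ∈ D 0, ‖T 0 z‖ ≤ B) :
    ∀ k, ∀ z ∈ D k, ‖T k z‖ ≤ B := by
  intro k
  induction k with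
  | zero => exact h0
  | succ k ih =>
      intro z hz
      rw [hT k, Function.comp_apply]
      exact ih _ (hinto k hz)

/-- The transported functional is the creation functional at the iterated pull-back:
`T k = T 0 ∘ Φ 0 ∘ ⋯ ∘ Φ (k−1)`, written with an explicit iterate. [folklore] -/
theorem transport_apply (Φ : ℕ → E → E) (T : ℕ → E → ℂ) (hT : ∀ k, T (k + 1) = T k ∘ Φ k) :
    ∀ k z, T k z = T 0 ((Nat.rec (motive := fun _ => E → E) id (fun j f => f ∘ Φ j) k) z) := by
  intro k
  induction k with
  | zero => intro z; rfl
  | succ k ih =>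
      intro z
      rw [hT k, Function.comp_apply, ih]
      rfl

end Transport

/-! ## §2 The layered design of [Balaban1988Convergent] (2.34)–(2.39), by name from `B14Radii` -/

section Layered

/-- **THE LOSSES SUM TO AT MOST HALF THE RADIUS.**  `Σ_{i<k} (shrink β i − shrink β (i+1))·ϱ₀ = β(1 − 2^{−k})ϱ₀ ≤ ϱ₀∕2`
for `0 ≤ β ≤ 1∕2`, `0 ≤ ϱ₀` (printed choice `β = 1∕4`) — (SHRINK)'s `hsum` is DESIGN. [folklore] -/
theorem sum_layeredLoss_le_half {β ϱ₀ : ℝ} (hβ0 : 0 ≤ β) (hβ : β ≤ 1 / 2) (hϱ : 0 ≤ ϱ₀) (k : ℕ) :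
    ∑ i ∈ range k, (shrink β i - shrink β (i + 1)) * ϱ₀ ≤ ϱ₀ / 2 := by
  rw [← sum_mul, sum_losses, one_sub_shrink]
  have h1 : (0 : ℝ) ≤ (1 / 2 : ℝ) ^ k := pow_nonneg (by norm_num) k
  have h2 : β * (1 - (1 / 2 : ℝ) ^ k) ≤ 1 / 2 := by nlinarith
  nlinarith

/-- The printed choice `β = 1∕4` qualifies. [folklore] -/
example {ϱ₀ : ℝ} (hϱ : 0 ≤ ϱ₀) (k : ℕ) :
    ∑ i ∈ range k, (shrink (1 / 4) i - shrink (1 / 4) (i + 1)) * ϱ₀ ≤ ϱ₀ / 2 :=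
  sum_layeredLoss_le_half (by norm_num) (by norm_num) hϱ k

/-- The losses are nonnegative for `β ≥ 0`. [folklore] -/
theorem layeredLoss_nonneg {β ϱ₀ : ℝ} (hβ0 : 0 ≤ β) (hϱ : 0 ≤ ϱ₀) (k : ℕ) :
    0 ≤ (shrink β k - shrink β (k + 1)) * ϱ₀ := by
  rw [shrink_sub_succ]
  positivity

variable {E : Type*} [PseudoMetricSpace E]

/-- **HALF THE RADIUS SURVIVES BY DESIGN.**  A space containing the closed ball of radius `shrink β k · ϱ₀` about `x`
contains the closed `ϱ₀∕2`-ball about `x`, since `shrink β k ≥ 1 − β ≥ 1∕2`. [folklore] -/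
theorem half_ball_subset_of_layered (Dk : Set E) (x : E) {β ϱ₀ : ℝ} (hβ0 : 0 ≤ β) (hβ : β ≤ 1 / 2) (hϱ : 0 ≤ ϱ₀)
    (k : ℕ) (h : closedBall x (shrink β k * ϱ₀) ⊆ Dk) : closedBall x (ϱ₀ / 2) ⊆ Dk := by
  refine (closedBall_subset_closedBall ?_).trans h
  have := one_sub_le_shrink hβ0 k
  nlinarith

/-- **THIN BY DESIGN.**  For ball-shaped spaces `D k = closedBall x (shrink β k · ϱ₀)` every point of `D (k+1)` has its
closed ball of radius the loss `(shrink β k − shrink β (k+1))·ϱ₀` inside `D k` (triangle inequality). [folklore] -/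
theorem thin_of_balls (x : E) (β ϱ₀ : ℝ) (k : ℕ) :
    ∀ z ∈ closedBall x (shrink β (k + 1) * ϱ₀),
      closedBall z ((shrink β k - shrink β (k + 1)) * ϱ₀) ⊆ closedBall x (shrink β k * ϱ₀) := by
  intro z hz y hy
  rw [mem_closedBall] at hz hy ⊢
  calc dist y x ≤ dist y z + dist z x := dist_triangle _ _ _
    _ ≤ (shrink β k - shrink β (k + 1)) * ϱ₀ + shrink β (k + 1) * ϱ₀ := add_le_add hy hz
    _ = shrink β k * ϱ₀ := by ring

/-- **(SHRINK) BY DESIGN.**  For the same ball-shaped spaces, a point whose closed loss-ball lies in `D k` lies in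
`D (k+1)` — (SHRINK) with `d k =` the loss, for `0 ≤ β ≤ 1`, `ϱ₀ ≥ 0` (a point of the small ball on the ray from
the centre witnesses it).
[folklore] -/
theorem shrink_of_balls {V : Type*} [SeminormedAddCommGroup V] [NormedSpace ℝ V] (x : V) {β ϱ₀ : ℝ} (hβ0 : 0 ≤ β)
    (hβ1 : β ≤ 1) (hϱ : 0 ≤ ϱ₀) (k : ℕ) :
    ∀ z : V, closedBall z ((shrink β k - shrink β (k + 1)) * ϱ₀) ⊆ closedBall x (shrink β k * ϱ₀) →
      z ∈ closedBall x (shrink β (k + 1) * ϱ₀) := by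
  intro z hz
  set r : ℝ := (shrink β k - shrink β (k + 1)) * ϱ₀ with hr
  have hr0 : 0 ≤ r := layeredLoss_nonneg hβ0 hϱ k
  rw [mem_closedBall, dist_eq_norm]
  by_cases hzx : ‖z - x‖ = 0
  · rw [hzx]
    have := one_sub_le_shrink hβ0 (k + 1)
    exact mul_nonneg (by linarith) hϱ
  · -- the point `y = z + (r ∕ ‖z − x‖) • (z − x)` lies at distance `r` from `z`, hence in the big ball, at distance
    -- `‖z − x‖ + r` from `x`
    have hpos : 0 < ‖z - x‖ := lt_of_le_of_ne (norm_nonneg _) (Ne.symm hzx)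
    set y : V := z + (r / ‖z - x‖) • (z - x) with hy
    have hyz : dist y z ≤ r := by
      rw [dist_eq_norm, hy, add_sub_cancel_left, norm_smul, Real.norm_eq_abs, abs_of_nonneg (by positivity),
        div_mul_cancel₀ _ hpos.ne']
    have hyin : y ∈ closedBall x (shrink β k * ϱ₀) := hz (mem_closedBall.2 hyz)
    rw [mem_closedBall, dist_eq_norm] at hyin
    have hyx : y - x = (1 + r / ‖z - x‖) • (z - x) := by
      rw [hy, add_smul, one_smul]; abel
    have hn : ‖y - x‖ = ‖z - x‖ + r := by
      rw [hyx, norm_smul, Real.norm_eq_abs, abs_of_nonneg (by positivity), add_mul, one_mul,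
        div_mul_cancel₀ _ hpos.ne']
    rw [hn] at hyin
    have : shrink β k * ϱ₀ - r = shrink β (k + 1) * ϱ₀ := by rw [hr]; ring
    linarith

end Layered

/-! ## §3 Node T's `LipBackground` from a transport chain -/

section Lip

variable {C : Carriers} {E : Type*} [NormedAddCommGroup E] [NormedSpace ℂ E]

/-- **`LipBackground` FROM A TRANSPORT CHAIN.**  For every admissible coupling sequence `g` and domain `X`: an embedding `ι`
of run-A backgrounds into a complex normed space dominated by the carrier's gauge; a chain of spaces `Dch g X k` (`k` =
number of later steps) with the CREATION MARGIN about every embedded background and the (SHRINK)∕`hsum` design clauses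
(as in `lipBackground_of_shrinkingMargin`); step maps `Φ g X k` ANALYTIC on `Dch g X (k+1)` and sending it INTO
`Dch g X k`; the scale-`j` term as a family `T g X k` TRANSPORTED by the maps (`T g X (k+1) = T g X k ∘ Φ g X k`) from a
CREATION functional `T g X 0` analytic on `Dch g X 0` and bounded there by `E₀e^{−κ d X}`; and the dictionary: after the
`N g X` later steps the transported term at the embedded background IS the real value `EA g U X`.  THEN node T's
`LipBackground EA W κ (fun g j => 8·E₀∕ϱ₀ g j)` — `lipBackground_of_shrinkingMargin` with its final-domain analyticity and
bound DISCHARGED by transport (§1). [folklore] -/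
theorem lipBackground_of_transportChain {EA : Functional C C.BgA} {W : Set (ℕ → ℝ)} {κ E₀ : ℝ}
    (ι : C.BgA → E) (Dch : (ℕ → ℝ) → C.Dom → ℕ → Set E) (Φ : (ℕ → ℝ) → C.Dom → ℕ → E → E)
    (N : (ℕ → ℝ) → C.Dom → ℕ) (ϱ₀ : (ℕ → ℝ) → ℕ → ℝ) (d : (ℕ → ℝ) → C.Dom → ℕ → ℝ)
    (T : (ℕ → ℝ) → C.Dom → ℕ → E → ℂ)
    (hϱ₀ : ∀ g ∈ W, ∀ j, 0 < ϱ₀ g j)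
    (hcreate : ∀ g ∈ W, ∀ (X : C.Dom) (U : C.BgA), closedBall (ι U) (ϱ₀ g (C.scale X)) ⊆ Dch g X 0)
    (hshrink : ∀ g ∈ W, ∀ (X : C.Dom) (k : ℕ) (z : E), closedBall z (d g X k) ⊆ Dch g X k → z ∈ Dch g X (k + 1))
    (hsum : ∀ g ∈ W, ∀ (X : C.Dom) (k : ℕ), ∑ i ∈ range k, d g X i ≤ ϱ₀ g (C.scale X) / 2)
    (hinto : ∀ g ∈ W, ∀ (X : C.Dom) (k : ℕ), MapsTo (Φ g X k) (Dch g X (k + 1)) (Dch g X k))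
    (hΦhol : ∀ g ∈ W, ∀ (X : C.Dom) (k : ℕ), DifferentiableOn ℂ (Φ g X k) (Dch g X (k + 1)))
    (hT : ∀ g ∈ W, ∀ (X : C.Dom) (k : ℕ), T g X (k + 1) = T g X k ∘ Φ g X k)
    (hT0hol : ∀ g ∈ W, ∀ X : C.Dom, DifferentiableOn ℂ (T g X 0) (Dch g X 0))
    (hT0bd : ∀ g ∈ W, ∀ X : C.Dom, ∀ z ∈ Dch g X 0, ‖T g X 0 z‖ ≤ E₀ * Real.exp (-(κ * C.d X)))
    (hreal : ∀ g ∈ W, ∀ (X : C.Dom) (U : C.BgA), T g X (N g X) (ι U) = (EA g U X : ℂ))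
    (hgauge : ∀ U U' : C.BgA, ‖ι U - ι U'‖ ≤ C.gauge U U') :
    LipBackground EA W κ (fun g j => 8 * E₀ / ϱ₀ g j) :=
  lipBackground_of_shrinkingMargin (EA := EA) (W := W) (κ := κ) (E₀ := E₀) ι Dch N ϱ₀ d
    (fun g X => T g X (N g X)) hϱ₀ hcreate hshrink hsum
    (fun g hg X => differentiableOn_transport (Dch g X) (Φ g X) (T g X) (hT g hg X) (hinto g hg X) (hΦhol g hg X)
      (hT0hol g hg X) (N g X))
    (fun g hg X => norm_transport_le (Dch g X) (Φ g X) (T g X) (hT g hg X) (hinto g hg X) (hT0bd g hg X) (N g X))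
    hreal hgauge

/-- **`LipBackground` FROM A DISPLACEMENT CHAIN** — the same with MAPS-INTO replaced by its producer: the next space is
`d`-THIN in the previous one and the step maps DISPLACE points of it by at most `d` (input (S1): the complex `H_k`-shift
sup bound against the room). [folklore] -/
theorem lipBackground_of_displacementChain {EA : Functional C C.BgA} {W : Set (ℕ → ℝ)} {κ E₀ : ℝ}
    (ι : C.BgA → E) (Dch : (ℕ → ℝ) → C.Dom → ℕ → Set E) (Φ : (ℕ → ℝ) → C.Dom → ℕ → E → E)
    (N : (ℕ → ℝ) → C.Dom → ℕ) (ϱ₀ : (ℕ → ℝ) → ℕ → ℝ) (d : (ℕ → ℝ) → C.Dom → ℕ → ℝ)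
    (T : (ℕ → ℝ) → C.Dom → ℕ → E → ℂ)
    (hϱ₀ : ∀ g ∈ W, ∀ j, 0 < ϱ₀ g j)
    (hcreate : ∀ g ∈ W, ∀ (X : C.Dom) (U : C.BgA), closedBall (ι U) (ϱ₀ g (C.scale X)) ⊆ Dch g X 0)
    (hshrink : ∀ g ∈ W, ∀ (X : C.Dom) (k : ℕ) (z : E), closedBall z (d g X k) ⊆ Dch g X k → z ∈ Dch g X (k + 1))
    (hsum : ∀ g ∈ W, ∀ (X : C.Dom) (k : ℕ), ∑ i ∈ range k, d g X i ≤ ϱ₀ g (C.scale X) / 2)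
    (hthin : ∀ g ∈ W, ∀ (X : C.Dom) (k : ℕ), ∀ z ∈ Dch g X (k + 1), closedBall z (d g X k) ⊆ Dch g X k)
    (hdisp : ∀ g ∈ W, ∀ (X : C.Dom) (k : ℕ), ∀ z ∈ Dch g X (k + 1), dist (Φ g X k z) z ≤ d g X k)
    (hΦhol : ∀ g ∈ W, ∀ (X : C.Dom) (k : ℕ), DifferentiableOn ℂ (Φ g X k) (Dch g X (k + 1)))
    (hT : ∀ g ∈ W, ∀ (X : C.Dom) (k : ℕ), T g X (k + 1) = T g X k ∘ Φ g X k)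
    (hT0hol : ∀ g ∈ W, ∀ X : C.Dom, DifferentiableOn ℂ (T g X 0) (Dch g X 0))
    (hT0bd : ∀ g ∈ W, ∀ X : C.Dom, ∀ z ∈ Dch g X 0, ‖T g X 0 z‖ ≤ E₀ * Real.exp (-(κ * C.d X)))
    (hreal : ∀ g ∈ W, ∀ (X : C.Dom) (U : C.BgA), T g X (N g X) (ι U) = (EA g U X : ℂ))
    (hgauge : ∀ U U' : C.BgA, ‖ι U - ι U'‖ ≤ C.gauge U U') :
    LipBackground EA W κ (fun g j => 8 * E₀ / ϱ₀ g j) :=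
  lipBackground_of_transportChain ι Dch Φ N ϱ₀ d T hϱ₀ hcreate hshrink hsum
    (fun g hg X => mapsTo_of_displacement (Dch g X) (Φ g X) (d g X) (hthin g hg X) (hdisp g hg X)) hΦhol hT hT0hol
    hT0bd hreal hgauge

/-- **`LipBackground` WITH THE LAYERED LOSSES AS DECREMENTS.**  `lipBackground_of_displacementChain` with the
decrements FIXED to the printed losses `d g X k := (shrink β k − shrink β (k+1))·ϱ₀ g (scale X)` (`0 ≤ β ≤ 1∕2`, printed
`β = 1∕4`), so that `hsum` is DISCHARGED by `sum_layeredLoss_le_half`; when the spaces are balls of radii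
`shrink β k · ϱ₀` about the embedded background, (SHRINK) and THIN are `shrink_of_balls` ∕ `thin_of_balls` (§2) and the
ONLY analytic inputs left are: creation analyticity∕bound, analyticity of the maps, the DISPLACEMENT `≤` the loss (S1),
transport, and the dictionary. [folklore] -/
theorem lipBackground_of_layeredDisplacement {EA : Functional C C.BgA} {W : Set (ℕ → ℝ)} {κ E₀ β : ℝ}
    (hβ0 : 0 ≤ β) (hβ : β ≤ 1 / 2)
    (ι : C.BgA → E) (Dch : (ℕ → ℝ) → C.Dom → ℕ → Set E) (Φ : (ℕ → ℝ) → C.Dom → ℕ → E → E)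
    (N : (ℕ → ℝ) → C.Dom → ℕ) (ϱ₀ : (ℕ → ℝ) → ℕ → ℝ) (T : (ℕ → ℝ) → C.Dom → ℕ → E → ℂ)
    (hϱ₀ : ∀ g ∈ W, ∀ j, 0 < ϱ₀ g j)
    (hcreate : ∀ g ∈ W, ∀ (X : C.Dom) (U : C.BgA), closedBall (ι U) (ϱ₀ g (C.scale X)) ⊆ Dch g X 0)
    (hshrink : ∀ g ∈ W, ∀ (X : C.Dom) (k : ℕ) (z : E),
      closedBall z ((shrink β k - shrink β (k + 1)) * ϱ₀ g (C.scale X)) ⊆ Dch g X k → z ∈ Dch g X (k + 1))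
    (hthin : ∀ g ∈ W, ∀ (X : C.Dom) (k : ℕ), ∀ z ∈ Dch g X (k + 1),
      closedBall z ((shrink β k - shrink β (k + 1)) * ϱ₀ g (C.scale X)) ⊆ Dch g X k)
    (hdisp : ∀ g ∈ W, ∀ (X : C.Dom) (k : ℕ), ∀ z ∈ Dch g X (k + 1),
      dist (Φ g X k z) z ≤ (shrink β k - shrink β (k + 1)) * ϱ₀ g (C.scale X))
    (hΦhol : ∀ g ∈ W, ∀ (X : C.Dom) (k : ℕ), DifferentiableOn ℂ (Φ g X k) (Dch g X (k + 1)))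
    (hT : ∀ g ∈ W, ∀ (X : C.Dom) (k : ℕ), T g X (k + 1) = T g X k ∘ Φ g X k)
    (hT0hol : ∀ g ∈ W, ∀ X : C.Dom, DifferentiableOn ℂ (T g X 0) (Dch g X 0))
    (hT0bd : ∀ g ∈ W, ∀ X : C.Dom, ∀ z ∈ Dch g X 0, ‖T g X 0 z‖ ≤ E₀ * Real.exp (-(κ * C.d X)))
    (hreal : ∀ g ∈ W, ∀ (X : C.Dom) (U : C.BgA), T g X (N g X) (ι U) = (EA g U X : ℂ))
    (hgauge : ∀ U U' : C.BgA, ‖ι U - ι U'‖ ≤ C.gauge U U') :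
    LipBackground EA W κ (fun g j => 8 * E₀ / ϱ₀ g j) :=
  lipBackground_of_displacementChain ι Dch Φ N ϱ₀
    (fun g X k => (shrink β k - shrink β (k + 1)) * ϱ₀ g (C.scale X)) T hϱ₀ hcreate hshrink
    (fun g hg X k => sum_layeredLoss_le_half hβ0 hβ (hϱ₀ g hg (C.scale X)).le k) hthin hdisp hΦhol hT hT0hol hT0bd
    hreal hgauge

end Lip

/-! ## §4 Non-vacuity: a genuinely moving chain -/

section Toy

/-- Translations of `ℂ` by the layered losses (`β = 1∕2`, `ϱ₀ = 2`): the spaces `D k = closedBall 0 (shrink (1∕2) k · 2)`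
are THIN by design, the maps `z ↦ z + (loss k)` displace by exactly the loss, hence map `D (k+1)` into `D k`, are entire,
and the transported functional `T k = id ∘ Φ 0 ∘ ⋯` is analytic and bounded by `2` on `D k` — all hypotheses of §1∕§2
jointly inhabited with non-identity maps. [folklore] -/
theorem toy_transportChain :
    let D : ℕ → Set ℂ := fun k => closedBall 0 (shrink (1 / 2) k * 2)
    let Φ : ℕ → ℂ → ℂ := fun k z => z + ((shrink (1 / 2) k - shrink (1 / 2) (k + 1)) * 2 : ℝ)
    (∀ k, MapsTo (Φ k) (D (k + 1)) (D k)) ∧ (∀ k, DifferentiableOn ℂ (Φ k) (D (k + 1))) ∧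
      (∀ k, ∀ z ∈ D k, ‖(fun (w : ℂ) => w) z‖ ≤ 2) ∧ closedBall (0 : ℂ) (2 / 2) ⊆ D 3 := by
  intro D Φ
  refine ⟨?_, ?_, ?_, ?_⟩
  · intro k
    refine mapsTo_of_displacement D Φ (fun k => (shrink (1 / 2) k - shrink (1 / 2) (k + 1)) * 2)
      (fun k => thin_of_balls (0 : ℂ) (1 / 2) 2 k) (fun k z _ => ?_) k
    show dist (z + (((shrink (1 / 2) k - shrink (1 / 2) (k + 1)) * 2 : ℝ) : ℂ)) z ≤ _
    rw [dist_eq_norm, add_sub_cancel_left, Complex.norm_real, Real.norm_eq_abs,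
      abs_of_nonneg (layeredLoss_nonneg (by norm_num) (by norm_num) k)]
  · intro k
    exact (differentiable_id.add (differentiable_const _)).differentiableOn
  · intro k z hz
    have h := mem_closedBall.1 hz
    rw [dist_zero_right] at h
    have hs : shrink (1 / 2) k ≤ 1 := B14Radii.shrink_le_one (by norm_num) k
    simpa using h.trans (by nlinarith)
  · exact half_ball_subset_of_layered (β := 1 / 2) (ϱ₀ := 2) (D 3) 0 (by norm_num) (by norm_num) (by norm_num) 3
      (fun w hw => hw)

end Toy

end Summit.QuantumFields.BalabanUV.T4Continuum.NE7MarginDisplacementChain
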